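/-
Copyright: seat `ym-line-sll-p3` (prover-ym-line-sll-p3-g0-0), route `SoftLoopLongLag`, crux `SoftLoopLagFloorToTorus`
(stmt-QuantumFields-22504), line `birth` (skeleton `Cruxes/SoftLoopLagFloorToTorus/Lines/birth.lean`).
-/
import Summits.QuantumFields.YangMills.Theorems.SoftLoopLongLagSoftLoopLagFloorToTorusDlrTransferKernelsG

/-!
# Registered stub K1 `stub_dlrTransferG` of crux `SoftLoopLagFloorToTorus` (stmt-QuantumFields-22504), line `birth`, BY NAME —
# part 3 of 3: the window arithmetic and the DLR transfer box → torus for EVERY compact gauge group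

WHAT.  `stub_dlrTransferG` (registered signature, objects of `Theorems/SoftLoopLongLagDefs.lean`): for every compact `G`, every lattice
representation `r` and reals `ε a δ κ c K` with `0 < ε`, `0 < δ`, `2δ < κ < 1`, `0 < c` and the window `13ε + 4δ < 2a`, the four inputs
— box floor `c·R³·β^{-2} ≤ Cov_{ν_η}(F_R, F_R∘α_R)` for cold-typical data (`R = ⌈β^ε⌉`, `n = ⌈β^a⌉`, `ν_η = coldKernel r β κ n η`), same-datum
mean smoothness `|ν_η(F_R∘α_R) − ν_η(F_R)| ≤ K·R⁸·β^{2δ−1}/n` for crude-good cold-typical data, torus large-field rarity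
`PlaquetteLargeFieldRarityG r.ρ δ`, and kernel cold typicality `γ_η(coldᶜ) ≤ e^{−β^δ}` for crude-good data — give `β₀` with, for
`β ≥ β₀`, eventually in the torus size, `(c/8)·R³·β^{-2} ≤ torusLagCov r β L F_R R`.  PROVED here: part 2's `torusLagCov_eq_boxKernel`
writes the torus covariance through the box kernels; the abstract law of total covariance with an exceptional event and a same-datum
mean difference (`total_covariance_lower_bound_sub`, constant `K₀ = B = (2R+1)⁴`) with the exceptional event `{lift ∈ Bad}` (part 2 §5,
mass `p ≤ 16(2n+3)⁴e^{−β^δ}`); off it the lifted datum is crude-good, so part 2 §6 gives `q − hk ≥ θ := (1−e)θ₀ − 5B²e` and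
`|k − h| ≤ ε' := |K|R⁸β^{2δ−1}/n + 2Be` (`θ₀ = c R³ β^{-2}`, `e = e^{−β^δ}`); the window arithmetic: with `Y = β^{3ε}·β^{-2} ≤ θ₀/c`,
`(|K|R⁸β^{2δ−1}/n)²/2 ≤ 32768K²·β^{-(2a−13ε−4δ)}·Y ≤ (c/16)Y`, `(θ₀ + 3B²)p ≤ (8c+1171875)·38416·β^{5ε+4a+2}e^{−β^δ}·Y ≤ (c/16)Y`,
`e ≤ 1/8` (all eventually in `β`), whence `∫q − ∫h∫k ≥ θ − ε'²/4 − (θ + 3B²)p ≥ θ₀ − θ₀/8 − (c/4)Y ≥ θ₀/8`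
(Georgii 2011 Thm. 4.17; Durrett 2019 §4.1).

WHAT THIS IS NOT.  No analysis: the floor (K4/T′), the mean smoothness (K2) and the cold typicality (K3) are the line's other stubs and
enter as hypotheses.  HONEST LABEL: the crux serves the RECORD-label rung R2xi-G (leaf `WeakCouplingRates.XiPow`, an UPPER bound on the
lattice mass gap for every compact simple `G`); NOT the Clay mass gap; no summit statement is touched.

References: H.-O. Georgii, *Gibbs Measures and Phase Transitions* (2011) Thm. 4.17; R. Durrett, *Probability* (2019) §4.1;
E. Seiler, LNP 159 (1982) Ch. 2.
-/

set_option autoImplicit false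

noncomputable section

open MeasureTheory Filter Topology
open Literature.Probability.LatticeModels (Site box mem_box)
open Literature.MathematicalPhysics Literature.MathematicalPhysics.QuantumFieldTheory
open Literature.MathematicalPhysics.QuantumLattice
open Summit.QuantumFields.YangMills.Theorems.WeakCouplingRates

namespace Summit.QuantumFields.YangMills.Theorems.SoftLoopLongLag

/-! ### §7. The registered stub K1 -/

section Stub

open Summit.QuantumFields.YangMills.Theorems.ColdBoxAllGroups (PlaquetteLargeFieldRarityG)

/-- Two `rpow` bookkeeping identities of the window arithmetic (`β > 0`). [folklore] -/
theorem rpow_window_identities {β ε a δ g : ℝ} (hβ : 0 < β) (hg : g = 2 * a - 13 * ε - 4 * δ) :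
    β ^ (5 * ε + 4 * a + 2) * ((β ^ ε) ^ 3 * β ^ (-(2 : ℝ))) = (β ^ ε) ^ 8 * (β ^ a) ^ 4 ∧
      ((β ^ ε) ^ 8 * β ^ (2 * δ - 1) / β ^ a) ^ 2 = β ^ (-g) * ((β ^ ε) ^ 3 * β ^ (-(2 : ℝ))) := by
  constructor
  · rw [← Real.rpow_natCast (β ^ ε) 3, ← Real.rpow_natCast (β ^ ε) 8, ← Real.rpow_natCast (β ^ a) 4,
      ← Real.rpow_mul hβ.le, ← Real.rpow_mul hβ.le, ← Real.rpow_mul hβ.le, ← Real.rpow_add hβ, ← Real.rpow_add hβ,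
      ← Real.rpow_add hβ]
    congr 1
    push_cast
    ring
  · rw [div_eq_mul_inv, ← Real.rpow_neg hβ.le a, ← Real.rpow_natCast (β ^ ε) 8, ← Real.rpow_natCast (β ^ ε) 3,
      ← Real.rpow_mul hβ.le, ← Real.rpow_mul hβ.le, ← Real.rpow_add hβ, ← Real.rpow_add hβ, ← Real.rpow_natCast _ 2,
      ← Real.rpow_mul hβ.le, ← Real.rpow_add hβ, ← Real.rpow_add hβ]
    congr 1
    rw [hg]
    push_cast
    ring

/-- **Registered stub `stub_dlrTransferG` of crux `stmt-QuantumFields-22504` (`SoftLoopLagFloorToTorus`, line `birth`)** — K1, by name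
and signature (objects of `Theorems/SoftLoopLongLagDefs.lean`): for every compact `G` and lattice representation `r`, the DLR law of
total covariance through the lag box `Λ_n` (`n = ⌈β^a⌉`) at the torus level with one interior conditioning layer — the box floor
`c·R³·β^{-2}` for cold-typical data, same-datum mean smoothness `K·R⁸·β^{2δ−1}/n` for crude-good cold-typical data, torus large-field
rarity `PlaquetteLargeFieldRarityG r.ρ δ` and kernel cold typicality `γ_η(coldᶜ) ≤ e^{−β^δ}` for crude-good data — give, on the window
`13ε + 4δ < 2a`, eventually in the torus size `(c/8)·R³·β^{-2} ≤ torusLagCov r β L F_R R` (`R = ⌈β^ε⌉`).  Proof: §4 writes the torus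
covariance through the box kernels; `total_covariance_lower_bound_sub` (constant `K₀ = (2R+1)⁴`) with the exceptional event
`{lift ∈ Bad}` (§5, mass `≤ 16(2n+3)⁴e^{−β^δ}`); off it the datum is crude-good, so §6 gives `q − hk ≥ (1−e)θ₀ − 5B²e` and
`|k − h| ≤ |K|R⁸β^{2δ−1}/n + 2Be`; the window makes `(|K|R⁸β^{2δ−1}/n)² ≤ (c/8)·β^{3ε−2} ≤ θ₀/8` and every `e^{−β^δ}` term is
eventually `≤ θ₀/16` (Georgii 2011 Thm. 4.17; Durrett 2019 §4.1).  HONEST LABEL: rung R2xi-G RECORD label, NOT the Clay gap. [folklore] -/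
theorem stub_dlrTransferG :
    ∀ (G : Type) [Group G] [TopologicalSpace G] [IsTopologicalGroup G] [CompactSpace G] [MeasurableSpace G] [BorelSpace G]
      (r : LatticeRep G) (ε a δ κ c K : ℝ), 0 < ε → 0 < δ → 2 * δ < κ → κ < 1 → 0 < c → 13 * ε + 4 * δ < 2 * a →
      -- box floor (K4-shape at `(ε, a, κ, c)`)
      (∃ β₀ : ℝ, ∀ β : ℝ, β₀ ≤ β → ∀ η : LGConfig 4 G,
          (2 : ENNReal)⁻¹ ≤ ymSpecification (d := 4) r.ρ β (lagBox ⌈β ^ a⌉₊) η (coldEvent r β κ (lagBox ⌈β ^ a⌉₊)) →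
          c * (⌈β ^ ε⌉₊ : ℝ) ^ 3 * β ^ (-(2 : ℝ)) ≤ lagCov (coldKernel r β κ ⌈β ^ a⌉₊ η) (softLoopObs r ⌈β ^ ε⌉₊) ⌈β ^ ε⌉₊) →
      -- same-datum mean smoothness (K2-shape at `(ε, a, δ, κ, K)`)
      (∃ β₀ : ℝ, ∀ β : ℝ, β₀ ≤ β → ∀ η : LGConfig 4 G, CrudeGoodCorona r β δ ⌈β ^ a⌉₊ η →
          (2 : ENNReal)⁻¹ ≤ ymSpecification (d := 4) r.ρ β (lagBox ⌈β ^ a⌉₊) η (coldEvent r β κ (lagBox ⌈β ^ a⌉₊)) →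
          |condMean r β κ ⌈β ^ a⌉₊ (fun U => softLoopObs r ⌈β ^ ε⌉₊ (timeShiftLG (G := G) ⌈β ^ ε⌉₊ U)) η -
              condMean r β κ ⌈β ^ a⌉₊ (softLoopObs r ⌈β ^ ε⌉₊) η|
            ≤ K * (⌈β ^ ε⌉₊ : ℝ) ^ 8 * β ^ (2 * δ - 1) / (⌈β ^ a⌉₊ : ℝ)) →
      -- torus large-field rarity (sibling route's L2-G, landed)
      PlaquetteLargeFieldRarityG r.ρ δ →
      -- kernel cold typicality for crude-good data (K3-shape at `(a, δ, κ)`)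
      (∃ β₀ : ℝ, ∀ β : ℝ, β₀ ≤ β → ∀ η : LGConfig 4 G, CrudeGoodCorona r β δ ⌈β ^ a⌉₊ η →
          ymSpecification (d := 4) r.ρ β (lagBox ⌈β ^ a⌉₊) η (coldEvent r β κ (lagBox ⌈β ^ a⌉₊))ᶜ ≤
            ENNReal.ofReal (Real.exp (-(β ^ δ)))) →
      ∃ β₀ : ℝ, ∀ β : ℝ, β₀ ≤ β → ∀ᶠ L : ℕ in atTop,
        c / 8 * (⌈β ^ ε⌉₊ : ℝ) ^ 3 * β ^ (-(2 : ℝ)) ≤ torusLagCov r β L (softLoopObs r ⌈β ^ ε⌉₊) ⌈β ^ ε⌉₊ := by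
  intro G _ _ _ _ _ _ r ε a δ κ c K hε hδ h2δ hκ1 hc hwin hfloor hsmooth hrare htyp
  obtain ⟨β₁, hfloor⟩ := hfloor
  obtain ⟨β₂, hsmooth⟩ := hsmooth
  obtain ⟨β₃, hrare⟩ := hrare
  obtain ⟨β₄, htyp⟩ := htyp
  haveI : SecondCountableTopology G := r.secondCountableTopology
  have ha : 0 < a := by linarith
  -- the window gap and the three asymptotic thresholds
  set g : ℝ := 2 * a - 13 * ε - 4 * δ with hg
  have hg0 : 0 < g := by rw [hg]; linarith
  have hE2 : ∀ᶠ β : ℝ in atTop, Real.exp (-(β ^ δ)) ≤ 8⁻¹ := by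
    have ht : Tendsto (fun β : ℝ => Real.exp (-(β ^ δ))) atTop (𝓝 0) :=
      Real.tendsto_exp_neg_atTop_nhds_zero.comp (tendsto_rpow_atTop hδ)
    exact ht.eventually (eventually_le_nhds (by norm_num))
  have hE3 : ∀ᶠ β : ℝ in atTop, 32768 * K ^ 2 * β ^ (-g) ≤ c / 16 := by
    have ht : Tendsto (fun β : ℝ => 32768 * K ^ 2 * β ^ (-g)) atTop (𝓝 (32768 * K ^ 2 * 0)) :=
      (tendsto_rpow_neg_atTop hg0).const_mul _
    rw [mul_zero] at ht
    exact ht.eventually (eventually_le_nhds (by positivity))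
  set CJ : ℝ := (8 * c + 1171875) * 38416 with hCJ
  have hCJ0 : 0 < CJ := by positivity
  have hE4 : ∀ᶠ β : ℝ in atTop, CJ * (β ^ (5 * ε + 4 * a + 2) * Real.exp (-(β ^ δ))) ≤ c / 16 := by
    have ht := (tendsto_rpow_mul_exp_neg_rpow (5 * ε + 4 * a + 2) hδ).const_mul CJ
    rw [mul_zero] at ht
    exact ht.eventually (eventually_le_nhds (by positivity))
  obtain ⟨β₅, hβ₅⟩ := Filter.eventually_atTop.1 (hE2.and (hE3.and hE4))
  refine ⟨max (max (max β₁ β₂) (max β₃ β₄)) (max β₅ 1), fun β hβ => ?_⟩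
  simp only [max_le_iff] at hβ
  obtain ⟨⟨⟨hb1, hb2⟩, hb3, hb4⟩, hb5, hb6⟩ := hβ
  have hβ0 : 0 < β := by linarith
  obtain ⟨hA2, hA3, hA4⟩ := hβ₅ β hb5
  obtain ⟨hid1, hid2⟩ := rpow_window_identities (ε := ε) (a := a) (δ := δ) hβ0 hg
  set R : ℕ := ⌈β ^ ε⌉₊ with hR
  set n : ℕ := ⌈β ^ a⌉₊ with hn
  -- sizes of `R`, `n`, the observable bound `B`, the floor `θ₀`, the scale `Y`
  have hu1 : 1 ≤ β ^ ε := Real.one_le_rpow hb6 hε.le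
  have hu0 : 0 < β ^ ε := by positivity
  have hRge : β ^ ε ≤ (R : ℝ) := Nat.le_ceil _
  have hRle : (R : ℝ) ≤ 2 * β ^ ε := (one_le_ceil_rpow_and_le hb6 hε.le).2
  have hva1 : 1 ≤ β ^ a := Real.one_le_rpow hb6 ha.le
  have hva0 : 0 < β ^ a := by positivity
  have hnge : β ^ a ≤ (n : ℝ) := Nat.le_ceil _
  have hnle : (n : ℝ) ≤ 2 * β ^ a := (one_le_ceil_rpow_and_le hb6 ha.le).2
  have hn0 : (0 : ℝ) < n := lt_of_lt_of_le hva0 hnge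
  have hβm2 : 0 < β ^ (-(2 : ℝ)) := Real.rpow_pos_of_pos hβ0 _
  have hβm2' : β ^ (-(2 : ℝ)) ≤ 1 := Real.rpow_le_one_of_one_le_of_nonpos hb6 (by norm_num)
  set B : ℝ := (2 * (R : ℝ) + 1) ^ 4 with hB
  set θ₀ : ℝ := c * (R : ℝ) ^ 3 * β ^ (-(2 : ℝ)) with hθ₀
  set Y : ℝ := (β ^ ε) ^ 3 * β ^ (-(2 : ℝ)) with hY
  set e : ℝ := Real.exp (-(β ^ δ)) with hedef
  have he0 : 0 < e := Real.exp_pos _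
  have hY0 : 0 < Y := by positivity
  have hθY : c * Y ≤ θ₀ := by
    rw [hθ₀, hY, ← mul_assoc]
    exact mul_le_mul_of_nonneg_right (mul_le_mul_of_nonneg_left (pow_le_pow_left₀ hu0.le hRge 3) hc.le) hβm2.le
  have hθ0 : 0 ≤ θ₀ := by positivity
  have hB0 : 0 ≤ B := by positivity
  have hBle : B ≤ 625 * (β ^ ε) ^ 4 := by
    have h5 : 2 * (R : ℝ) + 1 ≤ 5 * β ^ ε := by linarith
    calc B = (2 * (R : ℝ) + 1) ^ 4 := hB
      _ ≤ (5 * β ^ ε) ^ 4 := pow_le_pow_left₀ (by positivity) h5 4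
      _ = 625 * (β ^ ε) ^ 4 := by ring
  have hB2le : B ^ 2 ≤ 390625 * (β ^ ε) ^ 8 := by
    calc B ^ 2 ≤ (625 * (β ^ ε) ^ 4) ^ 2 := pow_le_pow_left₀ hB0 hBle 2
      _ = 390625 * (β ^ ε) ^ 8 := by ring
  have hθle : θ₀ ≤ 8 * c * (β ^ ε) ^ 8 := by
    have hR3 : (R : ℝ) ^ 3 ≤ (2 * β ^ ε) ^ 3 := pow_le_pow_left₀ (by positivity) hRle 3
    have h38 : (β ^ ε) ^ 3 ≤ (β ^ ε) ^ 8 := pow_le_pow_right₀ hu1 (by norm_num)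
    calc θ₀ = c * (R : ℝ) ^ 3 * β ^ (-(2 : ℝ)) := hθ₀
      _ ≤ c * (2 * β ^ ε) ^ 3 * 1 := mul_le_mul (mul_le_mul_of_nonneg_left hR3 hc.le) hβm2' hβm2.le (by positivity)
      _ = 8 * c * (β ^ ε) ^ 3 := by ring
      _ ≤ 8 * c * (β ^ ε) ^ 8 := mul_le_mul_of_nonneg_left h38 (by positivity)
  have hn4 : (2 * (n : ℝ) + 3) ^ 4 ≤ 2401 * (β ^ a) ^ 4 := by
    have h7 : 2 * (n : ℝ) + 3 ≤ 7 * β ^ a := by linarith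
    calc (2 * (n : ℝ) + 3) ^ 4 ≤ (7 * β ^ a) ^ 4 := pow_le_pow_left₀ (by positivity) h7 4
      _ = 2401 * (β ^ a) ^ 4 := by ring
  -- the junk terms: `J5 = (θ₀ + 3B²)·16(2n+3)⁴·e ≤ (c/16)·Y`, `ε₀² / 2 ≤ (c/16)·Y`
  set p : ℝ := 16 * (2 * (n : ℝ) + 3) ^ 4 * e with hp
  have hp0 : 0 ≤ p := by positivity
  have hJ5 : (θ₀ + 3 * B ^ 2) * p ≤ c / 16 * Y := by
    have h1 : θ₀ + 3 * B ^ 2 ≤ (8 * c + 1171875) * (β ^ ε) ^ 8 := by linarith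
    have h2 : p ≤ 38416 * (β ^ a) ^ 4 * e := by
      have h := mul_le_mul_of_nonneg_right hn4 (show (0 : ℝ) ≤ 16 * e by positivity)
      rw [hp]; linarith
    have h3 : (8 * c + 1171875) * (β ^ ε) ^ 8 * (38416 * (β ^ a) ^ 4 * e) = CJ * (β ^ (5 * ε + 4 * a + 2) * e) * Y := by
      have e1 : CJ * (β ^ (5 * ε + 4 * a + 2) * e) * Y = CJ * e * (β ^ (5 * ε + 4 * a + 2) * Y) := by ring
      rw [e1, hid1, hCJ]; ring
    calc (θ₀ + 3 * B ^ 2) * p ≤ (8 * c + 1171875) * (β ^ ε) ^ 8 * (38416 * (β ^ a) ^ 4 * e) :=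
          mul_le_mul h1 h2 hp0 (by positivity)
      _ = CJ * (β ^ (5 * ε + 4 * a + 2) * e) * Y := h3
      _ ≤ c / 16 * Y := mul_le_mul_of_nonneg_right hA4 hY0.le
  have hB2e : 0 ≤ B ^ 2 * e := by positivity
  have h48 : 48 * B ^ 2 * e ≤ (θ₀ + 3 * B ^ 2) * p := by
    have h16 : (16 : ℝ) ≤ 16 * (2 * (n : ℝ) + 3) ^ 4 := by
      have : (1 : ℝ) ≤ (2 * (n : ℝ) + 3) ^ 4 := one_le_pow₀ (by linarith)
      linarith
    have h16e : 16 * e ≤ p := by rw [hp]; exact mul_le_mul_of_nonneg_right h16 he0.le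
    have h3 : 3 * B ^ 2 * (16 * e) ≤ 3 * B ^ 2 * p := mul_le_mul_of_nonneg_left h16e (by positivity)
    have h4 : 0 ≤ θ₀ * p := mul_nonneg hθ0 hp0
    linarith
  set ε₀ : ℝ := |K| * (R : ℝ) ^ 8 * β ^ (2 * δ - 1) / (n : ℝ) with hε₀
  have hε₀0 : 0 ≤ ε₀ := by positivity
  have hJ3 : ε₀ ^ 2 / 2 ≤ c / 16 * Y := by
    have hs0 : 0 < β ^ (2 * δ - 1) := Real.rpow_pos_of_pos hβ0 _
    have hR8 : (R : ℝ) ^ 8 ≤ 256 * (β ^ ε) ^ 8 := by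
      calc (R : ℝ) ^ 8 ≤ (2 * β ^ ε) ^ 8 := pow_le_pow_left₀ (by positivity) hRle 8
        _ = 256 * (β ^ ε) ^ 8 := by ring
    have hε₀le : ε₀ ≤ 256 * |K| * ((β ^ ε) ^ 8 * β ^ (2 * δ - 1) / β ^ a) := by
      rw [hε₀]
      calc |K| * (R : ℝ) ^ 8 * β ^ (2 * δ - 1) / (n : ℝ)
          ≤ |K| * (256 * (β ^ ε) ^ 8) * β ^ (2 * δ - 1) / (n : ℝ) := by
            gcongr
        _ ≤ |K| * (256 * (β ^ ε) ^ 8) * β ^ (2 * δ - 1) / β ^ a :=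
            div_le_div_of_nonneg_left (by positivity) hva0 hnge
        _ = 256 * |K| * ((β ^ ε) ^ 8 * β ^ (2 * δ - 1) / β ^ a) := by ring
    have hsq : ε₀ ^ 2 ≤ (256 * |K| * ((β ^ ε) ^ 8 * β ^ (2 * δ - 1) / β ^ a)) ^ 2 := pow_le_pow_left₀ hε₀0 hε₀le 2
    rw [mul_pow, mul_pow, hid2, sq_abs] at hsq
    have h3 : ε₀ ^ 2 / 2 ≤ 32768 * K ^ 2 * β ^ (-g) * Y := by linarith
    calc ε₀ ^ 2 / 2 ≤ 32768 * K ^ 2 * β ^ (-g) * Y := h3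
      _ ≤ c / 16 * Y := mul_le_mul_of_nonneg_right hA3 hY0.le
  -- eventually in the torus size
  filter_upwards [hrare β hb3, eventually_gt_atTop (2 * (n + 6 * R + 2))] with L hL2 hLbig
  haveI := isProbabilityMeasure_wilsonMeasure (d := 4) (L := L + 1) (G := G) r.ρ r.continuous β
  rw [torusLagCov_eq_boxKernel r β (n := n) (Nat.lt_succ_of_lt hLbig)]
  -- the kernel quantities
  set Λ : Finset (QuantumLattice.ZdEdge 4) := lagBox n with hΛ
  set F : LGConfig 4 G → ℝ := softLoopObs r R with hF
  set h : GaugeConfig 4 (L + 1) G → ℝ := fun U => ∫ W, F W ∂(ymSpecification r.ρ β Λ (torusLift (L + 1) U)) with hh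
  set k : GaugeConfig 4 (L + 1) G → ℝ :=
    fun U => ∫ W, F (timeShiftLG (G := G) R W) ∂(ymSpecification r.ρ β Λ (torusLift (L + 1) U)) with hk
  set q : GaugeConfig 4 (L + 1) G → ℝ :=
    fun U => ∫ W, F W * F (timeShiftLG (G := G) R W) ∂(ymSpecification r.ρ β Λ (torusLift (L + 1) U)) with hq
  have hFc : Continuous F := continuous_softLoopObs r R
  have hFc' : Continuous fun U => F (timeShiftLG (G := G) R U) := hFc.comp (continuous_timeShiftLG R)
  have hqc : Continuous fun U => F U * F (timeShiftLG (G := G) R U) := hFc.mul hFc'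
  have hFK : ∀ U, |F U| ≤ B := abs_softLoopObs_le' r R
  have hFK' : ∀ U, |F (timeShiftLG (G := G) R U)| ≤ B := fun U => abs_softLoopObs_le' r R _
  have hqK : ∀ U, |F U * F (timeShiftLG (G := G) R U)| ≤ B ^ 2 := abs_softLoopObs_mul_le r R R
  have hml := measurable_torusLift (d := 4) (G := G) (L + 1)
  have hhm : Measurable h := (continuous_integral_ymSpecification r.ρ r.continuous β Λ hFc hFK).measurable.comp hml
  have hkm : Measurable k := (continuous_integral_ymSpecification r.ρ r.continuous β Λ hFc' hFK').measurable.comp hml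
  have hqm : Measurable q := (continuous_integral_ymSpecification r.ρ r.continuous β Λ hqc hqK).measurable.comp hml
  have hhK : ∀ U, |h U| ≤ B := fun U => abs_integral_ymSpecification_le r.ρ r.continuous β Λ hFK _
  have hkK : ∀ U, |k U| ≤ B := fun U => abs_integral_ymSpecification_le r.ρ r.continuous β Λ hFK' _
  have hqK' : ∀ U, |q U| ≤ B ^ 2 := fun U => abs_integral_ymSpecification_le r.ρ r.continuous β Λ hqK _
  -- the bad event and its mass
  set E : Set (GaugeConfig 4 (L + 1) G) := {U | torusLift (L + 1) U ∈
      ⋃ p ∈ plaquettesTouching (lagBox n),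
        {W : LGConfig 4 G | β ^ (2 * δ - 1) < plaqCostAt r.ρ p.1 p.2.1.1 p.2.1.2 W}} with hE
  have hEm : MeasurableSet E := hml (measurableSet_badSet_lagBox r β δ n)
  have hgood : ∀ U, U ∉ E → CrudeGoodCorona r β δ n (torusLift (L + 1) U) := fun U hU =>
    crudeGoodCorona_of_not_mem_badSet r hU
  have hμE : (wilsonMeasure (d := 4) (L := L + 1) r.ρ β).real E ≤ p := measureReal_badSet_lagBox_le r hL2
  -- off the bad event: the inner step
  set θ : ℝ := (1 - e) * θ₀ - 5 * B ^ 2 * e with hθ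
  have he2 : e ≤ 2⁻¹ := hA2.trans (by norm_num)
  have inner : ∀ U, U ∉ E → θ ≤ q U - h U * k U ∧ |k U - h U| ≤ ε₀ + 2 * B * e := by
    intro U hU
    have hg' := hgood U hU
    have hsm : (2 : ENNReal)⁻¹ ≤ ymSpecification (d := 4) r.ρ β (lagBox n) (torusLift (L + 1) U)
        (coldEvent r β κ (lagBox n)) →
        |condMean r β κ n (fun U => softLoopObs r R (timeShiftLG (G := G) R U)) (torusLift (L + 1) U) -
            condMean r β κ n (softLoopObs r R) (torusLift (L + 1) U)| ≤ ε₀ := by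
      intro hc'
      refine (hsmooth β hb2 _ hg' hc').trans ?_
      rw [hε₀]
      have e1 : K * (R : ℝ) ^ 8 * β ^ (2 * δ - 1) / (n : ℝ) = K * ((R : ℝ) ^ 8 * β ^ (2 * δ - 1) / (n : ℝ)) := by ring
      have e2 : |K| * (R : ℝ) ^ 8 * β ^ (2 * δ - 1) / (n : ℝ) = |K| * ((R : ℝ) ^ 8 * β ^ (2 * δ - 1) / (n : ℝ)) := by ring
      rw [e1, e2]
      exact mul_le_mul_of_nonneg_right (le_abs_self K) (by positivity)
    exact boxKernel_lagCov_ge_of_coldTypical r (htyp β hb4 _ hg') he0.le he2 hθ0 (hfloor β hb1 _) hsm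
  have hθe : θ₀ * e ≤ θ₀ * 8⁻¹ := mul_le_mul_of_nonneg_left hA2 hθ0
  have hθl : 0 ≤ θ := by rw [hθ]; linarith
  have key := total_covariance_lower_bound_sub hEm hhm hkm hqm hhK hkK hqK' hθl (fun U hU => (inner U hU).1)
    (fun U hU => (inner U hU).2) hμE
  -- window arithmetic
  have hε2 : (ε₀ + 2 * B * e) ^ 2 / 4 ≤ c / 16 * Y + c / 16 * Y := by
    have hsq : (ε₀ + 2 * B * e) ^ 2 ≤ 2 * ε₀ ^ 2 + 8 * (B ^ 2 * e) := by
      have he1 : e ≤ 1 := hA2.trans (by norm_num)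
      have h1 : (ε₀ + 2 * B * e) ^ 2 = 2 * ε₀ ^ 2 + 8 * (B ^ 2 * (e * e)) - (ε₀ - 2 * B * e) ^ 2 := by ring
      have h2 : B ^ 2 * (e * e) ≤ B ^ 2 * e := mul_le_mul_of_nonneg_left (mul_le_of_le_one_right he0.le he1) (sq_nonneg B)
      rw [h1]
      linarith [sq_nonneg (ε₀ - 2 * B * e)]
    linarith
  have hθe0 : 0 ≤ θ₀ * e := mul_nonneg hθ0 he0.le
  have hbad : (θ + 3 * B ^ 2) * p ≤ c / 16 * Y := by
    have hθle' : θ ≤ θ₀ := by rw [hθ]; linarith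
    exact (mul_le_mul_of_nonneg_right (by linarith) hp0).trans hJ5
  have hθge : θ₀ - θ₀ * 8⁻¹ - c / 16 * Y ≤ θ := by rw [hθ]; linarith
  have hgoal : c / 8 * (R : ℝ) ^ 3 * β ^ (-(2 : ℝ)) ≤ (∫ U, q U ∂(wilsonMeasure (d := 4) (L := L + 1) r.ρ β)) -
      (∫ U, h U ∂(wilsonMeasure (d := 4) (L := L + 1) r.ρ β)) * ∫ U, k U ∂(wilsonMeasure (d := 4) (L := L + 1) r.ρ β) := by
    have e8 : c / 8 * (R : ℝ) ^ 3 * β ^ (-(2 : ℝ)) = θ₀ / 8 := by rw [hθ₀]; ring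
    rw [e8]
    linarith
  exact hgoal

end Stub

end Summit.QuantumFields.YangMills.Theorems.SoftLoopLongLag

end
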